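import Summits.RiemannHypothesis.RiemannHypothesis.Theorems.GapsEvoDoorsFloorSpacingCriterion
import Summits.RiemannHypothesis.RiemannHypothesis.Theorems.GapsEvoDoorsDeltaCIFloorNineTenths
import Summits.RiemannHypothesis.RiemannHypothesis.Theorems.GapsEvoDoorsSpacingToCI

/-!
# GapsEvoDoors — the crux `FragmentToCI` (item stmt-RiemannHypothesis-22418) via the floor skeleton

Crux `FragmentToCI` of route GapsEvoDoors (rank 2, the door-(a) deciding rung of the cell rh-gaps,
D-0143/D-0145): for SOME finite window `Δ ≥ 1`, the GUE fragment «`F(α, T) → 1` uniformly on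
`1 < |α| ≤ Δ`» together with RH and one close pair of critical zeros below height `2001` gives
Conrey–Iwaniec's hypothesis (1.22), `∃ c > 0, SubnormalGapsHypothesis c`.

PROOF = the SECOND registered skeleton (floor fragment), all three stubs now tree theorems:
* `GapsEvoDoorsFloor.DeltaCIFloorNineTenths_holds` (item 23031): a window `Δ` (in fact `100`),
  `0 < λ < 1/2`, `0 ≤ f < 9/10` and an admissible `r` with positive floor certificate — Montgomery's
  triangle at `(100, 0.499, 0.89)`;
* `GapsEvoDoorsWindow.FloorSpacingCriterionAll_holds` (item 23032): the floor fragment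
  `F ≥ f₀ − o(1)` on the window (here `f₀ = 9/10`, implied by the two-sided fragment since
  `|F − 1| ≤ ε ⇒ F ≥ 9/10 − ε`), RH and the certificate give `SpacingDensityPos λ`;
* `GapsEvoDoorsSpacingToCI.SpacingToCI_holds` (item 22423): on RH a positive density of spacings
  with multiplicity below `λ < 1/2`, plus the close pair below `2001`, gives (1.22).

So `Δ_CI ≤ 100` is a tree theorem in the sense of the route (the cell's certified engine numbers
`Δ_CI(ε) ≈ 1.34…1.63`, `f*(Δ)`, are sharper and stay «computed ≠ proved»). The statement is
RH-CONDITIONAL and conditional on a pair-correlation FRAGMENT beyond the diagonal (an AH-refuting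
input): it is a rung about zero spacings, never a claim toward RH; the route's residual
`DoorsResidual` (RH from the two rungs) is summit-strength by design. Nothing here bears on the
truth of RH.
-/

noncomputable section

open Filter Set MeasureTheory Real

set_option linter.dupNamespace false  -- the mandated namespace repeats `RiemannHypothesis`

namespace Summit.RiemannHypothesis.RiemannHypothesis.Theorems.GapsEvoDoorsWindow

open Literature.NumberTheory.LFunctions Literature.NumberTheory.LFunctions.BGMM2023

/-- **Crux stmt-RiemannHypothesis-22418 (`FragmentToCI`) holds**: with the window of the floor
witness (`Δ = 100`), the two-sided fragment implies the floor `F ≥ 9/10 − ε`, the floor criterion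
gives a positive density of spacings below `λ = 0.499 < 1/2` mean spacings, and `SpacingToCI`
turns that (with the close pair below `2001`) into Conrey–Iwaniec's (1.22). -/
theorem FragmentToCI_holds :
    Summit.RiemannHypothesis.RiemannHypothesis.Theses.GapsEvoDoors.FragmentToCI := by
  unfold Summit.RiemannHypothesis.RiemannHypothesis.Theses.GapsEvoDoors.FragmentToCI
  obtain ⟨Δ, lam, f, r, hΔ, h0, h1, hf9, hf0, hev, hco, hin, htr, hle, hno, htail, hwin, hc⟩ :=
    GapsEvoDoorsFloor.DeltaCIFloorNineTenths_holds
  refine ⟨Δ, hΔ, fun hFF hRH h₀ ↦ ?_⟩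
  have hfloor : ∀ ε : ℝ, 0 < ε → ∃ T₀ : ℝ, ∀ T : ℝ, T₀ ≤ T → ∀ α : ℝ, 1 < |α| → |α| ≤ Δ →
      (9 / 10 : ℝ) - ε ≤ montgomeryFormFactor α T := by
    intro ε hε
    obtain ⟨T₀, hT₀⟩ := hFF ε hε
    refine ⟨T₀, fun T hT α h1' h2' ↦ ?_⟩
    have h := abs_le.1 (hT₀ T hT α h1' h2')
    linarith [h.1]
  have hcrit := FloorSpacingCriterionAll_holds
  unfold Summit.RiemannHypothesis.RiemannHypothesis.Theses.GapsEvoDoors.FloorSpacingCriterionAll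
    at hcrit
  have hSD : SpacingDensityPos lam :=
    hcrit (9 / 10) Δ hΔ hfloor hRH lam f r h0 hf9 hf0 hev hco hin htr hle hno htail hwin hc
  have hb := GapsEvoDoorsSpacingToCI.SpacingToCI_holds
  unfold Summit.RiemannHypothesis.RiemannHypothesis.Theses.GapsEvoDoors.SpacingToCI at hb
  exact hb hRH lam h0.le h1 hSD h₀

end Summit.RiemannHypothesis.RiemannHypothesis.Theorems.GapsEvoDoorsWindow

end
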